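import Summits.QuantumFields.YangMills.Theorems.UnitScaleTiltProp7HermiteOffsets
import HarnessLib

/-!
# Route `UnitScaleTilt`, crux K1 «MinimiserStabilityRegPr» (stmt-QuantumFields-19200), route-R E′ path (α′), row LEMMA-H-CURVED — FILE 2b:
# THE HERMITE FOLD — the separable C¹ blend operator on the finest torus: per direction `μ`, `(H_μ w)(x) = p(r)·w(x⌊μ⌋) + (1 − p(r))·w(x⌊μ⌋ + ℓe_μ)`,
# `r = (x_μ − h) mod ℓ` the offset above the lower centre, `x⌊μ⌋ = x − r e_μ` that centre line; its algebra (commutation, pull-out, linearity, convexity,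
# EXACT mass preservation on block-constant functions, interpolation at the centres)

Cell `ym3-torus`, D-0154 (3c) twin-width seat `ym-routeR-w1` (gen 5); row «routeR-w1 g5: LEMMA-H-CURVED» (namer ★ym-ust-19200-p1 g14, 2026-08-28 17:33Z; «F-H2 GO» 17:48Z).
THEOREMS ONLY (0 `def`, 0 `sorry`); `--supports stmt-QuantumFields-19200`, count-neutral.  YM₃ on T³ is a ladder rung (R3), not the Clay problem; nothing here claims a stub, the
crux, d = 4 or the mass gap.

WHY.  LEMMA-H-curved ⟸ biharmonic Dirichlet principle (✓ `Prop7CentreBiharmonicDirichlet`) + one explicit C¹ extension of coarse centre data whose LAPLACIAN energy is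
`O(ℓ⁻¹·Σ_c|δ_c f|²)` at `d = 3`.  ✓ `Prop7TentInterpolation` (N4) realises the C⁰ tent as the `d`-fold BOX FILTER of the block-constant extension `f ∘ iterBlockOf k` and controls
its GRADIENT energy; a tent's Laplacian energy is one power of `ℓ` too large (slope kinks on the cell faces).  THIS FILE replaces the box factor by the HERMITE factor
`H_μ`: on each run of `ℓ` sites between two consecutive centres in direction `μ` it blends the two centre-line values with a profile `p` (`p(0) = 1`; for the energy count
F-H2c takes `p(r) = (1 − r∕ℓ)²(1 + 2r∕ℓ)`, ✓ `Prop7HermiteProfile`, whose slope vanishes at both knots).  The architecture is the tent file's: the fold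
`H = H_{μ₁} ∘ ⋯ ∘ H_{μ_d}` written def-free as a `List.foldr` of the one-dimensional operators over `List.finRange P.d`; the factors commute with translations in the other
directions and with each other, a factor can be pulled out of the fold (`foldr_eq_hermStep_erase`), the fold is linear; NEW here (the tent needed Cauchy–Schwarz instead):
each factor is a CONVEX COMBINATION (`0 ≤ p ≤ 1`) — so `|H_μ w| ≤ H_μ|w|`, `(H_μ w)² ≤ H_μ(w²)`, monotone — and PRESERVES THE SITE SUM EXACTLY on functions constant along the
`μ`-runs (`Σ_x (H_μ u)(x) = Σ_x u(x)`): the energy count of F-H2c is then `Σ_x (Δ_μΦ)² ≤ Σ_x H_{others}((Δ_μ H_μ g)²) = Σ_x (Δ_μ H_μ g)²` with NO loss in the other directions.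
Interpolation: at a site all of whose offsets vanish (the translated centres `embIter k y`, `h = (ℓ−1)∕2`, ✓ `Prop7TentInterpolation.val_embIter`) every factor evaluates its
argument at the site itself, so `(H g)(embIter k y) = g(embIter k y) = f(y)`.

WHAT IS PROVED (ns `…Theorems.Prop7HermiteFold`; `ℓ : ℕ` with `ℓ ∣ |T^{(0)}|`, offset `h`, profile `p : ℕ → ℝ` arbitrary unless stated).
* (§1 = ✓ `Prop7HermiteOffsets`: the offset ∕ centre-line `ZMod` bookkeeping, imported.)
* §2 the fold: `hermStep_translate`, `foldr_translate`, `foldr_sub`, `hermStep_comm`, `foldr_eq_hermStep_erase` (verbatim architecture of ✓ `Prop7TentInterpolation` §2).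
* §3 convexity and mass: `abs_hermStep_le`, `sq_hermStep_le`, `hermStep_mono`, `foldr_abs_le`, `foldr_mono`, `foldr_nonneg`; ★ `sum_hermStep_eq` (exact mass preservation on
  `μ`-run-constant `u`), `runConst_hermStep` (run-constancy in `μ` survives a factor in `ν ≠ μ`), ★ `sum_foldr_eq`.
* §4 interpolation: `hermStep_of_offset_zero`, ★ `foldr_of_offsets_zero`, ★★ `foldr_embIter` (`(H(f ∘ Q))(embIter k y) = f y`, `Q` the translated `k`-block map).
HONEST SCOPE.  Finite bookkeeping on the torus `Site P 0`; no estimate of Bałaban's is asserted; the second-difference rows and the energy count are F-H2c.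

References: T. Bałaban, CMP 95 (1984) 17–40 [Balaban1984PropagatorsI] ((1.6) p.18, (1.18) p.20 — blocks and centres); CMP 102 (1985) 277–309 [Balaban1985Variational]
(Prop. 7 p.299).  Cubic Hermite blending is folklore numerical analysis.
-/

set_option autoImplicit false

noncomputable section

open scoped BigOperators

namespace Summit.QuantumFields.YangMills.Theorems.Prop7HermiteFold

open Literature.MathematicalPhysics.QuantumFieldTheory.Balaban1983to89
open Finset
open Summit.QuantumFields.YangMills.Theorems.Prop7TentInterpolation (sum_translate shift_eq_update)
open Summit.QuantumFields.YangMills.Theorems.Prop7HermiteOffsets (offset_add_ell corner_add_ell)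

variable {P : Params}

/-! ## §2 The Hermite fold: translations in other directions, linearity, commutation, pull-out -/

section Fold

variable (ℓ : ℕ) (h : ZMod (P.sitesPerDir 0)) (p : ℕ → ℝ)

/-- two updates in different coordinates commute (absolute form). [folklore] -/
theorem update_comm_abs {μ ν : Fin P.d} (hμν : μ ≠ ν) (x : Site P 0) (a b : ZMod (P.sitesPerDir 0)) :
    Function.update (Function.update x ν a) μ b = Function.update (Function.update x μ b) ν a := by
  funext κ
  by_cases h1 : κ = μ
  · subst h1; simp [hμν]
  · by_cases h2 : κ = ν
    · subst h2; simp [h1]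
    · simp [h1, h2]

/-- one Hermite factor in direction `ν` evaluated at a point moved in direction `μ ≠ ν`: offsets and centre lines are those of the unmoved point. [folklore] -/
theorem hermStep_apply_update_ne {μ ν : Fin P.d} (hμν : μ ≠ ν) (w : Site P 0 → ℝ) (x : Site P 0) (b : ZMod (P.sitesPerDir 0)) :
    (p (((Function.update x μ b) ν - h).val % ℓ) * w (Function.update (Function.update x μ b) ν ((Function.update x μ b) ν - (((((Function.update x μ b) ν - h).val % ℓ : ℕ)) : ZMod (P.sitesPerDir 0)))) + (1 - p (((Function.update x μ b) ν - h).val % ℓ)) * w (Function.update (Function.update x μ b) ν ((Function.update x μ b) ν - (((((Function.update x μ b) ν - h).val % ℓ : ℕ)) : ZMod (P.sitesPerDir 0)) + ((ℓ : ℕ) : ZMod (P.sitesPerDir 0)))))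
      = p ((x ν - h).val % ℓ) * w (Function.update (Function.update x μ b) ν (x ν - ((((x ν - h).val % ℓ : ℕ)) : ZMod (P.sitesPerDir 0))))
        + (1 - p ((x ν - h).val % ℓ)) * w (Function.update (Function.update x μ b) ν (x ν - ((((x ν - h).val % ℓ : ℕ)) : ZMod (P.sitesPerDir 0)) + ((ℓ : ℕ) : ZMod (P.sitesPerDir 0)))) := by
  simp only [Function.update_of_ne (Ne.symm hμν)]

/-- one Hermite factor commutes with a translation in ANOTHER coordinate. [folklore] -/
theorem hermStep_translate {μ ν : Fin P.d} (hμν : μ ≠ ν) (a : ZMod (P.sitesPerDir 0)) (w : Site P 0 → ℝ) (x : Site P 0) :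
    (p (((Function.update x ν (x ν + a)) μ - h).val % ℓ) * w (Function.update (Function.update x ν (x ν + a)) μ ((Function.update x ν (x ν + a)) μ - (((((Function.update x ν (x ν + a)) μ - h).val % ℓ : ℕ)) : ZMod (P.sitesPerDir 0)))) + (1 - p (((Function.update x ν (x ν + a)) μ - h).val % ℓ)) * w (Function.update (Function.update x ν (x ν + a)) μ ((Function.update x ν (x ν + a)) μ - (((((Function.update x ν (x ν + a)) μ - h).val % ℓ : ℕ)) : ZMod (P.sitesPerDir 0)) + ((ℓ : ℕ) : ZMod (P.sitesPerDir 0))))) = (p ((x μ - h).val % ℓ) * (fun z => w (Function.update z ν (z ν + a))) (Function.update x μ (x μ - ((((x μ - h).val % ℓ : ℕ)) : ZMod (P.sitesPerDir 0)))) + (1 - p ((x μ - h).val % ℓ)) * (fun z => w (Function.update z ν (z ν + a))) (Function.update x μ (x μ - ((((x μ - h).val % ℓ : ℕ)) : ZMod (P.sitesPerDir 0)) + ((ℓ : ℕ) : ZMod (P.sitesPerDir 0))))) := by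
  rw [hermStep_apply_update_ne ℓ h p (Ne.symm hμν)]
  simp only [Function.update_of_ne (Ne.symm hμν), update_comm_abs hμν]

/-- the Hermite fold over directions not containing `ν` commutes with translations in direction `ν`. [folklore] -/
theorem foldr_translate (l : List (Fin P.d)) (ν : Fin P.d) (hν : ν ∉ l) (a : ZMod (P.sitesPerDir 0)) (v : Site P 0 → ℝ) (x : Site P 0) :
    (List.foldr (fun (μ : Fin P.d) (w : Site P 0 → ℝ) (x : Site P 0) => p ((x μ - h).val % ℓ) * w (Function.update x μ (x μ - ((((x μ - h).val % ℓ : ℕ)) : ZMod (P.sitesPerDir 0)))) + (1 - p ((x μ - h).val % ℓ)) * w (Function.update x μ (x μ - ((((x μ - h).val % ℓ : ℕ)) : ZMod (P.sitesPerDir 0)) + ((ℓ : ℕ) : ZMod (P.sitesPerDir 0))))) v l) (Function.update x ν (x ν + a)) = (List.foldr (fun (μ : Fin P.d) (w : Site P 0 → ℝ) (x : Site P 0) => p ((x μ - h).val % ℓ) * w (Function.update x μ (x μ - ((((x μ - h).val % ℓ : ℕ)) : ZMod (P.sitesPerDir 0)))) + (1 - p ((x μ - h).val % ℓ)) * w (Function.update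 x μ (x μ - ((((x μ - h).val % ℓ : ℕ)) : ZMod (P.sitesPerDir 0)) + ((ℓ : ℕ) : ZMod (P.sitesPerDir 0))))) (fun z => v (Function.update z ν (z ν + a))) l) x := by
  induction l generalizing x with
  | nil => rfl
  | cons μ l ih =>
    have hμν : μ ≠ ν := fun e => hν (by simp [e])
    have hν' : ν ∉ l := fun e => hν (by simp [e])
    simp only [List.foldr_cons]
    rw [hermStep_translate ℓ h p hμν]
    exact congrArg₂ (· + ·) (congrArg _ (ih hν' _)) (congrArg _ (ih hν' _))

/-- the Hermite fold is additive. [folklore] -/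
theorem foldr_add (l : List (Fin P.d)) (v₁ v₂ : Site P 0 → ℝ) (x : Site P 0) :
    (List.foldr (fun (μ : Fin P.d) (w : Site P 0 → ℝ) (x : Site P 0) => p ((x μ - h).val % ℓ) * w (Function.update x μ (x μ - ((((x μ - h).val % ℓ : ℕ)) : ZMod (P.sitesPerDir 0)))) + (1 - p ((x μ - h).val % ℓ)) * w (Function.update x μ (x μ - ((((x μ - h).val % ℓ : ℕ)) : ZMod (P.sitesPerDir 0)) + ((ℓ : ℕ) : ZMod (P.sitesPerDir 0))))) (fun z => v₁ z + v₂ z) l) x = (List.foldr (fun (μ : Fin P.d) (w : Site P 0 → ℝ) (x : Site P 0) => p ((x μ - h).val % ℓ) * w (Function.update x μ (x μ - ((((x μ - h).val % ℓ : ℕ)) : ZMod (P.sitesPerDir 0)))) + (1 - p ((x μ - h).val % ℓ)) * w (Function.update x μ (x μ - ((((x μ - h).val % ℓ : ℕ)) : ZMod (P.sitesPerDir 0)) + ((ℓ : ℕ) : ZMod (P.sitesPerDir 0))))) v₁ l) x + (List.foldr (fun (μ : Fin P.d) (w : Site P 0 → ℝ) (x : Site P 0) => p ((x μ - h).val % ℓ)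 * w (Function.update x μ (x μ - ((((x μ - h).val % ℓ : ℕ)) : ZMod (P.sitesPerDir 0)))) + (1 - p ((x μ - h).val % ℓ)) * w (Function.update x μ (x μ - ((((x μ - h).val % ℓ : ℕ)) : ZMod (P.sitesPerDir 0)) + ((ℓ : ℕ) : ZMod (P.sitesPerDir 0))))) v₂ l) x := by
  induction l generalizing x with
  | nil => rfl
  | cons μ l ih =>
    simp only [List.foldr_cons]
    rw [ih, ih]; ring

/-- the Hermite fold is homogeneous. [folklore] -/
theorem foldr_smul (l : List (Fin P.d)) (c : ℝ) (v : Site P 0 → ℝ) (x : Site P 0) :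
    (List.foldr (fun (μ : Fin P.d) (w : Site P 0 → ℝ) (x : Site P 0) => p ((x μ - h).val % ℓ) * w (Function.update x μ (x μ - ((((x μ - h).val % ℓ : ℕ)) : ZMod (P.sitesPerDir 0)))) + (1 - p ((x μ - h).val % ℓ)) * w (Function.update x μ (x μ - ((((x μ - h).val % ℓ : ℕ)) : ZMod (P.sitesPerDir 0)) + ((ℓ : ℕ) : ZMod (P.sitesPerDir 0))))) (fun z => c * v z) l) x = c * (List.foldr (fun (μ : Fin P.d) (w : Site P 0 → ℝ) (x : Site P 0) => p ((x μ - h).val % ℓ) * w (Function.update x μ (x μ - ((((x μ - h).val % ℓ : ℕ)) : ZMod (P.sitesPerDir 0)))) + (1 - p ((x μ - h).val % ℓ)) * w (Function.update x μ (x μ - ((((x μ - h).val % ℓ : ℕ)) : ZMod (P.sitesPerDir 0)) + ((ℓ : ℕ) : ZMod (P.sitesPerDir 0))))) v l) x := by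
  induction l generalizing x with
  | nil => rfl
  | cons μ l ih =>
    simp only [List.foldr_cons]
    rw [ih, ih]; ring

/-- the Hermite fold of a difference. [folklore] -/
theorem foldr_sub (l : List (Fin P.d)) (v₁ v₂ : Site P 0 → ℝ) (x : Site P 0) :
    (List.foldr (fun (μ : Fin P.d) (w : Site P 0 → ℝ) (x : Site P 0) => p ((x μ - h).val % ℓ) * w (Function.update x μ (x μ - ((((x μ - h).val % ℓ : ℕ)) : ZMod (P.sitesPerDir 0)))) + (1 - p ((x μ - h).val % ℓ)) * w (Function.update x μ (x μ - ((((x μ - h).val % ℓ : ℕ)) : ZMod (P.sitesPerDir 0)) + ((ℓ : ℕ) : ZMod (P.sitesPerDir 0))))) (fun z => v₁ z - v₂ z) l) x = (List.foldr (fun (μ : Fin P.d) (w : Site P 0 → ℝ) (x : Site P 0) => p ((x μ - h).val % ℓ) * w (Function.update x μ (x μ - ((((x μ - h).val % ℓ : ℕ)) : ZMod (P.sitesPerDir 0)))) + (1 - p ((x μ - h).val % ℓ)) * w (Function.update x μ (x μ - ((((x μ - h).val % ℓ : ℕ)) : ZMod (P.sitesPerDir 0)) + ((ℓ : ℕ)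 : ZMod (P.sitesPerDir 0))))) v₁ l) x - (List.foldr (fun (μ : Fin P.d) (w : Site P 0 → ℝ) (x : Site P 0) => p ((x μ - h).val % ℓ) * w (Function.update x μ (x μ - ((((x μ - h).val % ℓ : ℕ)) : ZMod (P.sitesPerDir 0)))) + (1 - p ((x μ - h).val % ℓ)) * w (Function.update x μ (x μ - ((((x μ - h).val % ℓ : ℕ)) : ZMod (P.sitesPerDir 0)) + ((ℓ : ℕ) : ZMod (P.sitesPerDir 0))))) v₂ l) x := by
  induction l generalizing x with
  | nil => rfl
  | cons μ l ih =>
    simp only [List.foldr_cons]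
    rw [ih, ih]; ring

/-- two Hermite factors in different directions commute. [folklore] -/
theorem hermStep_comm {μ ν : Fin P.d} (hμν : μ ≠ ν) (w : Site P 0 → ℝ) (x : Site P 0) :
    (p ((x μ - h).val % ℓ) * (fun z => (p ((z ν - h).val % ℓ) * w (Function.update z ν (z ν - ((((z ν - h).val % ℓ : ℕ)) : ZMod (P.sitesPerDir 0)))) + (1 - p ((z ν - h).val % ℓ)) * w (Function.update z ν (z ν - ((((z ν - h).val % ℓ : ℕ)) : ZMod (P.sitesPerDir 0)) + ((ℓ : ℕ) : ZMod (P.sitesPerDir 0)))))) (Function.update x μ (x μ - ((((x μ - h).val % ℓ : ℕ)) : ZMod (P.sitesPerDir 0)))) + (1 - p ((x μ - h).val % ℓ)) * (fun z => (p ((z ν - h).val % ℓ) * w (Function.update z ν (z ν - ((((z ν - h).val % ℓ : ℕ)) : ZMod (P.sitesPerDir 0)))) + (1 - p ((z ν - h).val % ℓ)) * w (Function.update z ν (z ν - ((((z ν - h).val % ℓ : ℕ)) : ZMod (P.sitesPerDir 0)) + ((ℓ : ℕ) : ZMod (P.sitesPerDir 0)))))) (Function.update x μ (x μ - ((((x μ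 - h).val % ℓ : ℕ)) : ZMod (P.sitesPerDir 0)) + ((ℓ : ℕ) : ZMod (P.sitesPerDir 0))))) = (p ((x ν - h).val % ℓ) * (fun z => (p ((z μ - h).val % ℓ) * w (Function.update z μ (z μ - ((((z μ - h).val % ℓ : ℕ)) : ZMod (P.sitesPerDir 0)))) + (1 - p ((z μ - h).val % ℓ)) * w (Function.update z μ (z μ - ((((z μ - h).val % ℓ : ℕ)) : ZMod (P.sitesPerDir 0)) + ((ℓ : ℕ) : ZMod (P.sitesPerDir 0)))))) (Function.update x ν (x ν - ((((x ν - h).val % ℓ : ℕ)) : ZMod (P.sitesPerDir 0)))) + (1 - p ((x ν - h).val % ℓ)) * (fun z => (p ((z μ - h).val % ℓ) * w (Function.update z μ (z μ - ((((z μ - h).val % ℓ : ℕ)) : ZMod (P.sitesPerDir 0)))) + (1 - p ((z μ - h).val % ℓ)) * w (Function.update z μ (z μ - ((((z μ - h).val % ℓ : ℕ)) : ZMod (P.sitesPerDir 0)) + ((ℓ : ℕ) : ZMod (P.sitesPerDir 0)))))) (Function.update x ν (x ν - ((((x ν - h).val % ℓ : ℕ)) : ZMod (P.sitesPerDir 0))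 + ((ℓ : ℕ) : ZMod (P.sitesPerDir 0))))) := by
  simp only []
  rw [hermStep_apply_update_ne ℓ h p hμν, hermStep_apply_update_ne ℓ h p hμν,
    hermStep_apply_update_ne ℓ h p (Ne.symm hμν), hermStep_apply_update_ne ℓ h p (Ne.symm hμν)]
  simp only [update_comm_abs hμν]
  ring

/-- pulling one factor out of the Hermite fold: for `μ ∈ l` (`l` without repetitions), `fold l = H_μ ∘ fold (l.erase μ)`. [folklore] -/
theorem foldr_eq_hermStep_erase (l : List (Fin P.d)) (hl : l.Nodup) (μ : Fin P.d) (hμ : μ ∈ l) (v : Site P 0 → ℝ) (x : Site P 0) :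
    (List.foldr (fun (μ : Fin P.d) (w : Site P 0 → ℝ) (x : Site P 0) => p ((x μ - h).val % ℓ) * w (Function.update x μ (x μ - ((((x μ - h).val % ℓ : ℕ)) : ZMod (P.sitesPerDir 0)))) + (1 - p ((x μ - h).val % ℓ)) * w (Function.update x μ (x μ - ((((x μ - h).val % ℓ : ℕ)) : ZMod (P.sitesPerDir 0)) + ((ℓ : ℕ) : ZMod (P.sitesPerDir 0))))) v l) x = (p ((x μ - h).val % ℓ) * (List.foldr (fun (μ : Fin P.d) (w : Site P 0 → ℝ) (x : Site P 0) => p ((x μ - h).val % ℓ) * w (Function.update x μ (x μ - ((((x μ - h).val % ℓ : ℕ)) : ZMod (P.sitesPerDir 0)))) + (1 - p ((x μ - h).val % ℓ)) * w (Function.update x μ (x μ - ((((x μ - h).val % ℓ : ℕ)) : ZMod (P.sitesPerDir 0)) + ((ℓ : ℕ) : ZMod (P.sitesPerDir 0))))) v (l.erase μ)) (Function.update x μ (x μ - ((((x μ - h).val % ℓ : ℕ)) : ZMod (P.sitesPerDir 0)))) + (1 - p ((x μ - h).val % ℓ)) * (List.foldr (fun (μ : Fin P.d) (w : Site P 0 →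 ℝ) (x : Site P 0) => p ((x μ - h).val % ℓ) * w (Function.update x μ (x μ - ((((x μ - h).val % ℓ : ℕ)) : ZMod (P.sitesPerDir 0)))) + (1 - p ((x μ - h).val % ℓ)) * w (Function.update x μ (x μ - ((((x μ - h).val % ℓ : ℕ)) : ZMod (P.sitesPerDir 0)) + ((ℓ : ℕ) : ZMod (P.sitesPerDir 0))))) v (l.erase μ)) (Function.update x μ (x μ - ((((x μ - h).val % ℓ : ℕ)) : ZMod (P.sitesPerDir 0)) + ((ℓ : ℕ) : ZMod (P.sitesPerDir 0))))) := by
  induction l generalizing x with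
  | nil => exact absurd hμ List.not_mem_nil
  | cons ν l ih =>
    by_cases hνμ : ν = μ
    · subst hνμ
      simp only [List.foldr_cons, List.erase_cons_head]
    · have hμ' : μ ∈ l := by simpa [Ne.symm hνμ] using hμ
      have hl' : l.Nodup := (List.nodup_cons.mp hl).2
      rw [List.erase_cons_tail (by simpa using hνμ)]
      simp only [List.foldr_cons]
      rw [ih hl' hμ', ih hl' hμ']
      exact hermStep_comm ℓ h p hνμ _ x

end Fold

/-! ## §3 Convexity and exact mass preservation -/

section Mass

variable (ℓ : ℕ) (h : ZMod (P.sitesPerDir 0)) (p : ℕ → ℝ)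

/-- a convex combination: `|H_μ w| ≤ H_μ|w|` (profile values in `[0,1]` on offsets `< ℓ`). [folklore] -/
theorem abs_hermStep_le (hp : ∀ r : ℕ, r < ℓ → 0 ≤ p r ∧ p r ≤ 1) (hℓ : 0 < ℓ) (μ : Fin P.d) (w : Site P 0 → ℝ) (x : Site P 0) :
    |(p ((x μ - h).val % ℓ) * w (Function.update x μ (x μ - ((((x μ - h).val % ℓ : ℕ)) : ZMod (P.sitesPerDir 0)))) + (1 - p ((x μ - h).val % ℓ)) * w (Function.update x μ (x μ - ((((x μ - h).val % ℓ : ℕ)) : ZMod (P.sitesPerDir 0)) + ((ℓ : ℕ) : ZMod (P.sitesPerDir 0)))))| ≤ (p ((x μ - h).val % ℓ) * (fun z => |w z|) (Function.update x μ (x μ - ((((x μ - h).val % ℓ : ℕ)) : ZMod (P.sitesPerDir 0)))) + (1 - p ((x μ - h).val % ℓ)) * (fun z => |w z|) (Function.update x μ (x μ - ((((x μ - h).val % ℓ : ℕ)) : ZMod (P.sitesPerDir 0)) + ((ℓ : ℕ) : ZMod (P.sitesPerDir 0))))) := by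
  obtain ⟨h0, h1⟩ := hp _ (Nat.mod_lt ((x μ - h).val) hℓ)
  simp only []
  refine (abs_add_le _ _).trans ?_
  rw [abs_mul, abs_mul, abs_of_nonneg h0, abs_of_nonneg (by linarith : (0 : ℝ) ≤ 1 - p ((x μ - h).val % ℓ))]

/-- Jensen for the square: `(H_μ w)² ≤ H_μ(w²)`. [folklore] -/
theorem sq_hermStep_le (hp : ∀ r : ℕ, r < ℓ → 0 ≤ p r ∧ p r ≤ 1) (hℓ : 0 < ℓ) (μ : Fin P.d) (w : Site P 0 → ℝ) (x : Site P 0) :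
    (p ((x μ - h).val % ℓ) * w (Function.update x μ (x μ - ((((x μ - h).val % ℓ : ℕ)) : ZMod (P.sitesPerDir 0)))) + (1 - p ((x μ - h).val % ℓ)) * w (Function.update x μ (x μ - ((((x μ - h).val % ℓ : ℕ)) : ZMod (P.sitesPerDir 0)) + ((ℓ : ℕ) : ZMod (P.sitesPerDir 0))))) ^ 2 ≤ (p ((x μ - h).val % ℓ) * (fun z => w z ^ 2) (Function.update x μ (x μ - ((((x μ - h).val % ℓ : ℕ)) : ZMod (P.sitesPerDir 0)))) + (1 - p ((x μ - h).val % ℓ)) * (fun z => w z ^ 2) (Function.update x μ (x μ - ((((x μ - h).val % ℓ : ℕ)) : ZMod (P.sitesPerDir 0)) + ((ℓ : ℕ) : ZMod (P.sitesPerDir 0))))) := by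
  obtain ⟨h0, h1⟩ := hp _ (Nat.mod_lt ((x μ - h).val) hℓ)
  simp only []
  set a := p ((x μ - h).val % ℓ)
  set u := w (Function.update x μ (x μ - ((((x μ - h).val % ℓ : ℕ)) : ZMod (P.sitesPerDir 0))))
  set v := w (Function.update x μ (x μ - ((((x μ - h).val % ℓ : ℕ)) : ZMod (P.sitesPerDir 0)) + ((ℓ : ℕ) : ZMod (P.sitesPerDir 0))))
  nlinarith [mul_nonneg (mul_nonneg h0 (by linarith : (0 : ℝ) ≤ 1 - a)) (sq_nonneg (u - v))]

/-- monotonicity of one factor. [folklore] -/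
theorem hermStep_mono (hp : ∀ r : ℕ, r < ℓ → 0 ≤ p r ∧ p r ≤ 1) (hℓ : 0 < ℓ) (μ : Fin P.d) {w w' : Site P 0 → ℝ} (hww : ∀ z, w z ≤ w' z) (x : Site P 0) :
    (p ((x μ - h).val % ℓ) * w (Function.update x μ (x μ - ((((x μ - h).val % ℓ : ℕ)) : ZMod (P.sitesPerDir 0)))) + (1 - p ((x μ - h).val % ℓ)) * w (Function.update x μ (x μ - ((((x μ - h).val % ℓ : ℕ)) : ZMod (P.sitesPerDir 0)) + ((ℓ : ℕ) : ZMod (P.sitesPerDir 0))))) ≤ (p ((x μ - h).val % ℓ) * w' (Function.update x μ (x μ - ((((x μ - h).val % ℓ : ℕ)) : ZMod (P.sitesPerDir 0)))) + (1 - p ((x μ - h).val % ℓ)) * w' (Function.update x μ (x μ - ((((x μ - h).val % ℓ : ℕ)) : ZMod (P.sitesPerDir 0)) + ((ℓ : ℕ) : ZMod (P.sitesPerDir 0))))) := by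
  obtain ⟨h0, h1⟩ := hp _ (Nat.mod_lt ((x μ - h).val) hℓ)
  exact add_le_add (mul_le_mul_of_nonneg_left (hww _) h0) (mul_le_mul_of_nonneg_left (hww _) (by linarith))

/-- monotonicity of the fold. [folklore] -/
theorem foldr_mono (hp : ∀ r : ℕ, r < ℓ → 0 ≤ p r ∧ p r ≤ 1) (hℓ : 0 < ℓ) (l : List (Fin P.d)) {w w' : Site P 0 → ℝ} (hww : ∀ z, w z ≤ w' z) (x : Site P 0) :
    (List.foldr (fun (μ : Fin P.d) (w : Site P 0 → ℝ) (x : Site P 0) => p ((x μ - h).val % ℓ) * w (Function.update x μ (x μ - ((((x μ - h).val % ℓ : ℕ)) : ZMod (P.sitesPerDir 0)))) + (1 - p ((x μ - h).val % ℓ)) * w (Function.update x μ (x μ - ((((x μ - h).val % ℓ : ℕ)) : ZMod (P.sitesPerDir 0)) + ((ℓ : ℕ) : ZMod (P.sitesPerDir 0))))) w l) x ≤ (List.foldr (fun (μ : Fin P.d) (w : Site P 0 → ℝ) (x : Site P 0) => p ((x μ - h).val % ℓ) * w (Function.update x μ (x μ - ((((x μ - h).val % ℓ : ℕ)) : ZMod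 (P.sitesPerDir 0)))) + (1 - p ((x μ - h).val % ℓ)) * w (Function.update x μ (x μ - ((((x μ - h).val % ℓ : ℕ)) : ZMod (P.sitesPerDir 0)) + ((ℓ : ℕ) : ZMod (P.sitesPerDir 0))))) w' l) x := by
  induction l generalizing x with
  | nil => exact hww x
  | cons μ l ih =>
    simp only [List.foldr_cons]
    exact hermStep_mono ℓ h p hp hℓ μ ih x

/-- `|fold w| ≤ fold |w|`. [folklore] -/
theorem foldr_abs_le (hp : ∀ r : ℕ, r < ℓ → 0 ≤ p r ∧ p r ≤ 1) (hℓ : 0 < ℓ) (l : List (Fin P.d)) (w : Site P 0 → ℝ) (x : Site P 0) :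
    |(List.foldr (fun (μ : Fin P.d) (w : Site P 0 → ℝ) (x : Site P 0) => p ((x μ - h).val % ℓ) * w (Function.update x μ (x μ - ((((x μ - h).val % ℓ : ℕ)) : ZMod (P.sitesPerDir 0)))) + (1 - p ((x μ - h).val % ℓ)) * w (Function.update x μ (x μ - ((((x μ - h).val % ℓ : ℕ)) : ZMod (P.sitesPerDir 0)) + ((ℓ : ℕ) : ZMod (P.sitesPerDir 0))))) w l) x| ≤ (List.foldr (fun (μ : Fin P.d) (w : Site P 0 → ℝ) (x : Site P 0) => p ((x μ - h).val % ℓ) * w (Function.update x μ (x μ - ((((x μ - h).val % ℓ : ℕ)) : ZMod (P.sitesPerDir 0)))) + (1 - p ((x μ - h).val % ℓ)) * w (Function.update x μ (x μ - ((((x μ - h).val % ℓ : ℕ)) : ZMod (P.sitesPerDir 0)) + ((ℓ : ℕ) : ZMod (P.sitesPerDir 0))))) (fun z => |w z|) l) x := by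
  induction l generalizing x with
  | nil => exact le_rfl
  | cons μ l ih =>
    simp only [List.foldr_cons]
    exact (abs_hermStep_le ℓ h p hp hℓ μ _ x).trans (hermStep_mono ℓ h p hp hℓ μ ih x)

/-- Jensen for the fold: `(fold w)² ≤ fold (w²)`. [folklore] -/
theorem foldr_sq_le (hp : ∀ r : ℕ, r < ℓ → 0 ≤ p r ∧ p r ≤ 1) (hℓ : 0 < ℓ) (l : List (Fin P.d)) (w : Site P 0 → ℝ) (x : Site P 0) :
    ((List.foldr (fun (μ : Fin P.d) (w : Site P 0 → ℝ) (x : Site P 0) => p ((x μ - h).val % ℓ) * w (Function.update x μ (x μ - ((((x μ - h).val % ℓ : ℕ)) : ZMod (P.sitesPerDir 0)))) + (1 - p ((x μ - h).val % ℓ)) * w (Function.update x μ (x μ - ((((x μ - h).val % ℓ : ℕ)) : ZMod (P.sitesPerDir 0)) + ((ℓ : ℕ) : ZMod (P.sitesPerDir 0))))) w l) x) ^ 2 ≤ (List.foldr (fun (μ : Fin P.d) (w : Site P 0 → ℝ) (x : Site P 0) => p ((x μ - h).val % ℓ) * w (Function.update x μ (x μ - ((((x μ - h).val % ℓ : ℕ))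 : ZMod (P.sitesPerDir 0)))) + (1 - p ((x μ - h).val % ℓ)) * w (Function.update x μ (x μ - ((((x μ - h).val % ℓ : ℕ)) : ZMod (P.sitesPerDir 0)) + ((ℓ : ℕ) : ZMod (P.sitesPerDir 0))))) (fun z => w z ^ 2) l) x := by
  induction l generalizing x with
  | nil => exact le_rfl
  | cons μ l ih =>
    simp only [List.foldr_cons]
    exact (sq_hermStep_le ℓ h p hp hℓ μ _ x).trans (hermStep_mono ℓ h p hp hℓ μ ih x)

/-- ★ **EXACT MASS PRESERVATION**: for `u` constant along the `μ`-runs (`u(x) = u(x⌊μ⌋)`), `Σ_x (H_μ u)(x) = Σ_x u(x)` — whatever the profile. [folklore] -/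
theorem sum_hermStep_eq (hℓN : ℓ ∣ P.sitesPerDir 0) (μ : Fin P.d) (u : Site P 0 → ℝ)
    (hu : ∀ x : Site P 0, u x = u (Function.update x μ (x μ - ((((x μ - h).val % ℓ : ℕ)) : ZMod (P.sitesPerDir 0))))) :
    ∑ x : Site P 0, (p ((x μ - h).val % ℓ) * u (Function.update x μ (x μ - ((((x μ - h).val % ℓ : ℕ)) : ZMod (P.sitesPerDir 0)))) + (1 - p ((x μ - h).val % ℓ)) * u (Function.update x μ (x μ - ((((x μ - h).val % ℓ : ℕ)) : ZMod (P.sitesPerDir 0)) + ((ℓ : ℕ) : ZMod (P.sitesPerDir 0))))) = ∑ x : Site P 0, u x := by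
  have h2 : ∀ x : Site P 0, u (Function.update x μ (x μ - ((((x μ - h).val % ℓ : ℕ)) : ZMod (P.sitesPerDir 0)) + ((ℓ : ℕ) : ZMod (P.sitesPerDir 0)))) = u (Function.update x μ (x μ + ((ℓ : ℕ) : ZMod (P.sitesPerDir 0)))) := by
    intro x
    rw [hu (Function.update x μ (x μ + ((ℓ : ℕ) : ZMod (P.sitesPerDir 0)))), corner_add_ell ℓ h hℓN]
  have h1 : ∀ x : Site P 0, (p ((x μ - h).val % ℓ) * u (Function.update x μ (x μ - ((((x μ - h).val % ℓ : ℕ)) : ZMod (P.sitesPerDir 0)))) + (1 - p ((x μ - h).val % ℓ)) * u (Function.update x μ (x μ - ((((x μ - h).val % ℓ : ℕ)) : ZMod (P.sitesPerDir 0)) + ((ℓ : ℕ) : ZMod (P.sitesPerDir 0))))) = p ((x μ - h).val % ℓ) * u x + (1 - p ((x μ - h).val % ℓ)) * u (Function.update x μ (x μ + ((ℓ : ℕ) : ZMod (P.sitesPerDir 0)))) := by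
    intro x; rw [← hu x, h2 x]
  rw [Finset.sum_congr rfl (fun x _ => h1 x), Finset.sum_add_distrib]
  have h3 : ∑ x : Site P 0, (1 - p ((x μ - h).val % ℓ)) * u (Function.update x μ (x μ + ((ℓ : ℕ) : ZMod (P.sitesPerDir 0))))
      = ∑ x : Site P 0, (1 - p ((x μ - h).val % ℓ)) * u x := by
    rw [← sum_translate μ ((ℓ : ℕ) : ZMod (P.sitesPerDir 0)) (fun x => (1 - p ((x μ - h).val % ℓ)) * u x)]
    refine Finset.sum_congr rfl fun x _ => ?_
    rw [offset_add_ell ℓ h hℓN]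
  rw [h3, ← Finset.sum_add_distrib]
  refine Finset.sum_congr rfl fun x _ => ?_
  ring

/-- run-constancy in direction `μ` survives a Hermite factor in a direction `ν ≠ μ`. [folklore] -/
theorem runConst_hermStep {μ ν : Fin P.d} (hμν : μ ≠ ν) (u : Site P 0 → ℝ)
    (hu : ∀ x : Site P 0, u x = u (Function.update x μ (x μ - ((((x μ - h).val % ℓ : ℕ)) : ZMod (P.sitesPerDir 0))))) (x : Site P 0) :
    (p ((x ν - h).val % ℓ) * u (Function.update x ν (x ν - ((((x ν - h).val % ℓ : ℕ)) : ZMod (P.sitesPerDir 0)))) + (1 - p ((x ν - h).val % ℓ)) * u (Function.update x ν (x ν - ((((x ν - h).val % ℓ : ℕ)) : ZMod (P.sitesPerDir 0)) + ((ℓ : ℕ) : ZMod (P.sitesPerDir 0))))) = (p (((Function.update x μ (x μ - ((((x μ - h).val % ℓ : ℕ)) : ZMod (P.sitesPerDir 0)))) ν - h).val % ℓ) * u (Function.update (Function.update x μ (x μ - ((((x μ - h).val % ℓ : ℕ)) : ZMod (P.sitesPerDir 0)))) ν ((Function.update x μ (x μ - ((((x μ - h).val % ℓ : ℕ)) : ZMod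 (P.sitesPerDir 0)))) ν - (((((Function.update x μ (x μ - ((((x μ - h).val % ℓ : ℕ)) : ZMod (P.sitesPerDir 0)))) ν - h).val % ℓ : ℕ)) : ZMod (P.sitesPerDir 0)))) + (1 - p (((Function.update x μ (x μ - ((((x μ - h).val % ℓ : ℕ)) : ZMod (P.sitesPerDir 0)))) ν - h).val % ℓ)) * u (Function.update (Function.update x μ (x μ - ((((x μ - h).val % ℓ : ℕ)) : ZMod (P.sitesPerDir 0)))) ν ((Function.update x μ (x μ - ((((x μ - h).val % ℓ : ℕ)) : ZMod (P.sitesPerDir 0)))) ν - (((((Function.update x μ (x μ - ((((x μ - h).val % ℓ : ℕ)) : ZMod (P.sitesPerDir 0)))) ν - h).val % ℓ : ℕ)) : ZMod (P.sitesPerDir 0)) + ((ℓ : ℕ) : ZMod (P.sitesPerDir 0))))) := by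
  rw [hermStep_apply_update_ne ℓ h p hμν]
  have key : ∀ b : ZMod (P.sitesPerDir 0), u (Function.update x ν b) = u (Function.update (Function.update x μ (x μ - ((((x μ - h).val % ℓ : ℕ)) : ZMod (P.sitesPerDir 0)))) ν b) := by
    intro b
    rw [hu (Function.update x ν b), Function.update_of_ne hμν, update_comm_abs hμν]
  rw [key, key]

/-- run-constancy in direction `μ` survives the fold over directions not containing `μ`. [folklore] -/
theorem runConst_foldr (l : List (Fin P.d)) {μ : Fin P.d} (hμ : μ ∉ l) (u : Site P 0 → ℝ)
    (hu : ∀ x : Site P 0, u x = u (Function.update x μ (x μ - ((((x μ - h).val % ℓ : ℕ)) : ZMod (P.sitesPerDir 0))))) (x : Site P 0) :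
    (List.foldr (fun (μ : Fin P.d) (w : Site P 0 → ℝ) (x : Site P 0) => p ((x μ - h).val % ℓ) * w (Function.update x μ (x μ - ((((x μ - h).val % ℓ : ℕ)) : ZMod (P.sitesPerDir 0)))) + (1 - p ((x μ - h).val % ℓ)) * w (Function.update x μ (x μ - ((((x μ - h).val % ℓ : ℕ)) : ZMod (P.sitesPerDir 0)) + ((ℓ : ℕ) : ZMod (P.sitesPerDir 0))))) u l) x = (List.foldr (fun (μ : Fin P.d) (w : Site P 0 → ℝ) (x : Site P 0) => p ((x μ - h).val % ℓ) * w (Function.update x μ (x μ - ((((x μ - h).val % ℓ : ℕ)) : ZMod (P.sitesPerDir 0)))) + (1 - p ((x μ - h).val % ℓ)) * w (Function.update x μ (x μ - ((((x μ - h).val % ℓ : ℕ)) : ZMod (P.sitesPerDir 0)) + ((ℓ : ℕ) : ZMod (P.sitesPerDir 0))))) u l) (Function.update x μ (x μ - ((((x μ - h).val % ℓ : ℕ)) : ZMod (P.sitesPerDir 0)))) := by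
  induction l generalizing x with
  | nil => exact hu x
  | cons ν l ih =>
    have hμν : μ ≠ ν := fun e => hμ (by simp [e])
    have hμ' : μ ∉ l := fun e => hμ (by simp [e])
    simp only [List.foldr_cons]
    exact runConst_hermStep ℓ h p hμν _ (ih hμ') x

/-- ★ **EXACT MASS PRESERVATION FOR THE FOLD**: `Σ_x (fold l u)(x) = Σ_x u(x)` for `u` constant along the runs of every direction in `l` (`l` without repetitions). [folklore] -/
theorem sum_foldr_eq (hℓN : ℓ ∣ P.sitesPerDir 0) (l : List (Fin P.d)) (hl : l.Nodup) (u : Site P 0 → ℝ)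
    (hu : ∀ μ ∈ l, ∀ x : Site P 0, u x = u (Function.update x μ (x μ - ((((x μ - h).val % ℓ : ℕ)) : ZMod (P.sitesPerDir 0))))) :
    ∑ x : Site P 0, (List.foldr (fun (μ : Fin P.d) (w : Site P 0 → ℝ) (x : Site P 0) => p ((x μ - h).val % ℓ) * w (Function.update x μ (x μ - ((((x μ - h).val % ℓ : ℕ)) : ZMod (P.sitesPerDir 0)))) + (1 - p ((x μ - h).val % ℓ)) * w (Function.update x μ (x μ - ((((x μ - h).val % ℓ : ℕ)) : ZMod (P.sitesPerDir 0)) + ((ℓ : ℕ) : ZMod (P.sitesPerDir 0))))) u l) x = ∑ x : Site P 0, u x := by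
  induction l with
  | nil => rfl
  | cons ν l ih =>
    obtain ⟨hνl, hl'⟩ := List.nodup_cons.mp hl
    simp only [List.foldr_cons]
    rw [sum_hermStep_eq ℓ h p hℓN ν _ (runConst_foldr ℓ h p l hνl u (hu ν (by simp)))]
    exact ih hl' (fun μ hμ => hu μ (by simp [hμ]))

end Mass

/-! ## §4 Interpolation at the centres -/

section Interp

variable (ℓ : ℕ) (h : ZMod (P.sitesPerDir 0)) (p : ℕ → ℝ)

/-- a Hermite factor at a point of zero offset returns the point value (`p(0) = 1`). [folklore] -/
theorem hermStep_of_offset_zero (hp0 : p 0 = 1) (μ : Fin P.d) (w : Site P 0 → ℝ) (x : Site P 0) (hx : (x μ - h).val % ℓ = 0) :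
    (p ((x μ - h).val % ℓ) * w (Function.update x μ (x μ - ((((x μ - h).val % ℓ : ℕ)) : ZMod (P.sitesPerDir 0)))) + (1 - p ((x μ - h).val % ℓ)) * w (Function.update x μ (x μ - ((((x μ - h).val % ℓ : ℕ)) : ZMod (P.sitesPerDir 0)) + ((ℓ : ℕ) : ZMod (P.sitesPerDir 0))))) = w x := by
  rw [hx, hp0, Nat.cast_zero, sub_zero, Function.update_eq_self]
  ring

/-- ★ the fold at a point all of whose offsets (in the directions of `l`) vanish returns the point value. [folklore] -/
theorem foldr_of_offsets_zero (hp0 : p 0 = 1) (l : List (Fin P.d)) (w : Site P 0 → ℝ) (x : Site P 0) (hx : ∀ μ ∈ l, (x μ - h).val % ℓ = 0) :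
    (List.foldr (fun (μ : Fin P.d) (w : Site P 0 → ℝ) (x : Site P 0) => p ((x μ - h).val % ℓ) * w (Function.update x μ (x μ - ((((x μ - h).val % ℓ : ℕ)) : ZMod (P.sitesPerDir 0)))) + (1 - p ((x μ - h).val % ℓ)) * w (Function.update x μ (x μ - ((((x μ - h).val % ℓ : ℕ)) : ZMod (P.sitesPerDir 0)) + ((ℓ : ℕ) : ZMod (P.sitesPerDir 0))))) w l) x = w x := by
  induction l with
  | nil => rfl
  | cons ν l ih =>
    simp only [List.foldr_cons]
    rw [hermStep_of_offset_zero ℓ h p hp0 ν _ x (hx ν (by simp))]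
    exact ih (fun μ hμ => hx μ (by simp [hμ]))

end Interp

section Centres

open B5Eq118OneStroke (iterBlockOf mem_iterBlock mem_iterBlock_iff)
open B15DeterminingSets (embIter)
open Summit.QuantumFields.YangMills.Theorems.Prop7TentInterpolation (val_embIter)

/-- the centres have zero offsets for `ℓ = L^k`, `h = (L^k − 1)∕2`: `((embIter k y)_μ − h) mod L^k = 0`. [cite: Balaban1987RG1, (0.1) p.251] -/
theorem offset_embIter {k : ℕ} (hk : k ≤ P.m + P.K) (y : Site P k) (μ : Fin P.d) :
    ((embIter k y) μ - ((((P.L ^ k - 1) / 2 : ℕ)) : ZMod (P.sitesPerDir 0))).val % P.L ^ k = 0 := by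
  have hv := val_embIter hk y μ
  have e : (embIter k y) μ - ((((P.L ^ k - 1) / 2 : ℕ)) : ZMod (P.sitesPerDir 0)) = ((((y μ).val * P.L ^ k : ℕ)) : ZMod (P.sitesPerDir 0)) := by
    rw [← ZMod.natCast_zmod_val ((embIter k y) μ), hv]; push_cast; ring
  have hdvd : P.L ^ k ∣ P.sitesPerDir 0 := ⟨P.sitesPerDir k, by
    unfold Params.sitesPerDir; rw [Nat.sub_zero, mul_left_comm, ← pow_add, Nat.add_sub_cancel' hk]⟩
  rw [e, ZMod.val_natCast, Nat.mod_mod_of_dvd _ hdvd, Nat.mul_mod_left]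

/-- the translated `k`-block map at a centre: `B^k(embIter k y − h·𝟙) = y`. [cite: Balaban1984PropagatorsI, (1.18) p.20] -/
theorem iterBlockOf_embIter_sub {k : ℕ} (hk : k ≤ P.m + P.K) (y : Site P k) :
    iterBlockOf k (fun μ => (embIter k y) μ - ((((P.L ^ k - 1) / 2 : ℕ)) : ZMod (P.sitesPerDir 0))) = y := by
  rw [← mem_iterBlock, mem_iterBlock_iff hk]
  intro μ
  have hv := val_embIter hk y μ
  have e : (embIter k y) μ - ((((P.L ^ k - 1) / 2 : ℕ)) : ZMod (P.sitesPerDir 0)) = ((((y μ).val * P.L ^ k : ℕ)) : ZMod (P.sitesPerDir 0)) := by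
    rw [← ZMod.natCast_zmod_val ((embIter k y) μ), hv]; push_cast; ring
  have hN : P.L ^ k * P.sitesPerDir k = P.sitesPerDir 0 := by
    unfold Params.sitesPerDir; rw [Nat.sub_zero, mul_left_comm, ← pow_add, Nat.add_sub_cancel' hk]
  have hy : (y μ).val < P.sitesPerDir k := ZMod.val_lt (y μ)
  have hlt : (y μ).val * P.L ^ k < P.sitesPerDir 0 :=
    calc (y μ).val * P.L ^ k < P.sitesPerDir k * P.L ^ k := Nat.mul_lt_mul_of_pos_right hy (pow_pos P.L_pos k)
      _ = P.sitesPerDir 0 := by rw [mul_comm, hN]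
  show ((embIter k y) μ - ((((P.L ^ k - 1) / 2 : ℕ)) : ZMod (P.sitesPerDir 0))).val / P.L ^ k = (y μ).val
  rw [e, ZMod.val_natCast, Nat.mod_eq_of_lt hlt, Nat.mul_div_cancel _ (pow_pos P.L_pos k)]

/-- ★★ **INTERPOLATION AT THE CENTRES**: the Hermite fold (all directions, `ℓ = L^k`, `h = (L^k−1)∕2`, `p(0) = 1`) of the translated block-constant extension
`x ↦ f(B^k(x − h·𝟙))` takes the value `f(y)` at the centre `embIter k y`. [cite: Balaban1984PropagatorsI, (1.18) p.20] -/
theorem foldr_embIter {k : ℕ} (hk : k ≤ P.m + P.K) (p : ℕ → ℝ) (hp0 : p 0 = 1) (f : Site P k → ℝ) (y : Site P k) :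
    (List.foldr (fun (μ : Fin P.d) (w : Site P 0 → ℝ) (x : Site P 0) => p ((x μ - ((((P.L ^ k - 1) / 2 : ℕ)) : ZMod (P.sitesPerDir 0))).val % P.L ^ k) * w (Function.update x μ (x μ - ((((x μ - ((((P.L ^ k - 1) / 2 : ℕ)) : ZMod (P.sitesPerDir 0))).val % P.L ^ k : ℕ)) : ZMod (P.sitesPerDir 0)))) + (1 - p ((x μ - ((((P.L ^ k - 1) / 2 : ℕ)) : ZMod (P.sitesPerDir 0))).val % P.L ^ k)) * w (Function.update x μ (x μ - ((((x μ - ((((P.L ^ k - 1) / 2 : ℕ)) : ZMod (P.sitesPerDir 0))).val % P.L ^ k : ℕ)) : ZMod (P.sitesPerDir 0)) + ((P.L ^ k : ℕ) : ZMod (P.sitesPerDir 0))))) (fun x => f (iterBlockOf k (fun μ => x μ - ((((P.L ^ k - 1) / 2 : ℕ)) : ZMod (P.sitesPerDir 0))))) (List.finRange P.d)) (embIter k y) = f y := by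
  rw [foldr_of_offsets_zero (P.L ^ k) _ p hp0 _ _ _ (fun μ _ => offset_embIter hk y μ)]
  show f (iterBlockOf k _) = f y
  rw [iterBlockOf_embIter_sub hk]

end Centres



end Summit.QuantumFields.YangMills.Theorems.Prop7HermiteFold

end
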